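import Mathlib
import HarnessLib
import Summits.HubbardSuperconductivity.HubbardSuperconductivity.Theorems.KLProgrammeKLRegimeTwoVolumeTowerBudgetLaws
import Summits.HubbardSuperconductivity.HubbardSuperconductivity.Theorems.KLProgrammeKLRegimeEngineV8E5WitnessRowsG
import Summits.HubbardSuperconductivity.HubbardSuperconductivity.Theorems.KLProgrammeKLRegimeEngineTowerModelDefsRate

/-!
# Route `KLProgramme` — crux K3, VL child `KLRegimeVolumeLimitV17F3` (stmt-HubbardSuperconductivity-23356), skeleton «cauchy» v12W-9 (3fe75b6ca60710d7):
# THE RE-TYPED ATOM `stub_vl_HE1free` IS IMPLIED BY ITS v12W-4…8 TEXT (seat hubbard-kl-k3c4-p1 g20, VL lead; `--supports` 23356)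

v12W-9 re-types `stub_vl_HE1free` (cure (c1) of «(VL)-HE1-LEVEL0-DEG2», pen (R313)(2)): E1's degree law `S₀ j (2m) ≤ C₀·klWtBudget P Q₁ U (j+1) (2m)` is asked only for
`2m ≥ 4`, and the degree-2 read-outs obey `S₀ j 2 ≤ C₀·Q₁.CE·ε_{n_β+1}·4^{−(j+1)}`.  Since `klWtBudget P Q₁ U (j+1) 2 = Q₁.CE·ε_{j+1}·4^{−(j+1)}`
(`klWtBudget_two_eq_inv_pow`) and `ε_{j+1} ≤ ε_{n_β+1}` for `j ≤ n_β` (`epsCoupling_mono`), the OLD text implies the NEW one: every E1 route to the old text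
(e.g. `…V11HE1FreeOfTopFrameTowerEven.he1free_of_topFrameTowerEvenFree`) closes the re-typed stub by one application of
* **`he1free'_of_he1free`**.
Quantifier threading; nothing asserts either text, VL, K3 or superconductivity. [cite: BenfattoGiulianiMastropietro2006, §2.8 (2.83)]
-/

noncomputable section

namespace Summit.HubbardSuperconductivity.HubbardSuperconductivity.Theorems.TwoVolumeSource

set_option linter.dupNamespace false -- summit = problem name (single-conjunct summit), D-0017

open Finset Filter Topology Literature.MathematicalPhysics.QuantumLattice GrassmannAlgebra Literature.Probability.LatticeModels
open Summit.HubbardSuperconductivity.HubbardSuperconductivity.Theorems.KLRegimeSplit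
open Summit.HubbardSuperconductivity.HubbardSuperconductivity.Theorems.KLProgrammeLegKernels
open Summit.HubbardSuperconductivity.HubbardSuperconductivity.Theorems.EngineV8
open Summit.HubbardSuperconductivity.HubbardSuperconductivity.Theorems.TwoVolumeDefect

/-- **The v12W-4…8 text of `stub_vl_HE1free` implies its v12W-9 re-typing** (degree-2 law at `ε_{n_β+1}` instead of `ε_{j+1}`; degrees `≥ 4` unchanged).
[folklore: `ε_{j+1} ≤ ε_{n_β+1}`; cite: BenfattoGiulianiMastropietro2006, §2.8 (2.83)] -/
theorem he1free'_of_he1free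
    (HE1 : ∀ (P : SplitConsts) (R : RenConsts), P.WF → R.WF2 →
      ∃ Q₁ : EngConsts, 0 ≤ Q₁.CE ∧ ∃ C₀ : ℝ, 0 ≤ C₀ ∧
        ∃ c₇ : ℝ, 0 < c₇ ∧ ∀ c : ℝ, 0 < c → c ≤ c₇ → ∃ U₇ : ℝ, 0 < U₇ ∧
          ∀ μ ∈ klWindowC, ∀ U : ℝ, 0 < U → U ≤ U₇ → ∀ β : ℝ, klBetaMin ≤ β → β ≤ Real.exp (c / U ^ 2) →
            ∃ S₀ : ℕ → ℕ → ℝ, (∀ j m, 0 ≤ S₀ j m) ∧ (∀ j, j ≤ nScales β → ∀ m, 1 ≤ m → S₀ j (2 * m) ≤ C₀ * klWtBudget P Q₁ U (j + 1) (2 * m)) ∧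
            ∃ L₂ : ℕ, ∃ M₂ : ℕ → ℕ, ∀ (L M : ℕ) [NeZero L] [NeZero M], L₂ ≤ L → M₂ L ≤ M →
              (∀ k, k ≤ nScales β → hubbardEffPartitionFnCT L M β U μ 0 (klFlowFrameU L M β U μ (nScales β + 1)) (klScale klE0 (k + 1)) ≠ 0) ∧
              (∀ j, j ≤ nScales β → ∀ (m : ℕ) (q : Fin m) (w : SpaceTimeIdx L M × SectorLeg (sectorCount j)),
                klWtPinnedSumAt L M β μ (klFlowFrameU L M β U μ (nScales β + 1)) j j m (klEffectiveAction L M β U μ (klFlowFrameU L M β U μ (nScales β + 1)) klE0 (j + 1)) q w ≤ S₀ j m)) :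
    ∀ (P : SplitConsts) (R : RenConsts), P.WF → R.WF2 →
      ∃ Q₁ : EngConsts, 0 ≤ Q₁.CE ∧ ∃ C₀ : ℝ, 0 ≤ C₀ ∧
        ∃ c₇ : ℝ, 0 < c₇ ∧ ∀ c : ℝ, 0 < c → c ≤ c₇ → ∃ U₇ : ℝ, 0 < U₇ ∧
          ∀ μ ∈ klWindowC, ∀ U : ℝ, 0 < U → U ≤ U₇ → ∀ β : ℝ, klBetaMin ≤ β → β ≤ Real.exp (c / U ^ 2) →
            ∃ S₀ : ℕ → ℕ → ℝ, (∀ j m, 0 ≤ S₀ j m) ∧ (∀ j, j ≤ nScales β → ∀ m, 2 ≤ m → S₀ j (2 * m) ≤ C₀ * klWtBudget P Q₁ U (j + 1) (2 * m)) ∧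
            (∀ j, j ≤ nScales β → S₀ j 2 ≤ C₀ * Q₁.CE * epsCoupling P U (nScales β + 1) * ((4 : ℝ) ^ (j + 1))⁻¹) ∧
            ∃ L₂ : ℕ, ∃ M₂ : ℕ → ℕ, ∀ (L M : ℕ) [NeZero L] [NeZero M], L₂ ≤ L → M₂ L ≤ M →
              (∀ k, k ≤ nScales β → hubbardEffPartitionFnCT L M β U μ 0 (klFlowFrameU L M β U μ (nScales β + 1)) (klScale klE0 (k + 1)) ≠ 0) ∧
              (∀ j, j ≤ nScales β → ∀ (m : ℕ) (q : Fin m) (w : SpaceTimeIdx L M × SectorLeg (sectorCount j)),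
                klWtPinnedSumAt L M β μ (klFlowFrameU L M β U μ (nScales β + 1)) j j m (klEffectiveAction L M β U μ (klFlowFrameU L M β U μ (nScales β + 1)) klE0 (j + 1)) q w ≤ S₀ j m) := by
  intro P R hP hR2
  have hKl : 0 ≤ P.Klam := le_trans zero_le_one hP.1
  obtain ⟨Q₁, hQ₁, C₀, hC₀, c₇, hc₇, h⟩ := HE1 P R hP hR2
  refine ⟨Q₁, hQ₁, C₀, hC₀, c₇, hc₇, fun c hc hcc => ?_⟩
  obtain ⟨U₇, hU₇, h'⟩ := h c hc hcc
  refine ⟨U₇, hU₇, fun μ hμ U hU hUU β hβmin hβc => ?_⟩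
  obtain ⟨S₀, hS₀0, hS₀law, L₂, M₂, h''⟩ := h' μ hμ U hU hUU β hβmin hβc
  refine ⟨S₀, hS₀0, fun j hj m hm => hS₀law j hj m (by omega), fun j hj => ?_, L₂, M₂, h''⟩
  have h2 := hS₀law j hj 1 le_rfl
  rw [mul_one, klWtBudget_two_eq_inv_pow] at h2
  refine h2.trans ?_
  have hε : epsCoupling P U (j + 1) ≤ epsCoupling P U (nScales β + 1) := epsCoupling_mono hKl U (by omega)
  have h4 : (0 : ℝ) ≤ ((4 : ℝ) ^ (j + 1))⁻¹ := by positivity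
  calc C₀ * (Q₁.CE * epsCoupling P U (j + 1) * ((4 : ℝ) ^ (j + 1))⁻¹)
      = C₀ * Q₁.CE * epsCoupling P U (j + 1) * ((4 : ℝ) ^ (j + 1))⁻¹ := by ring
    _ ≤ C₀ * Q₁.CE * epsCoupling P U (nScales β + 1) * ((4 : ℝ) ^ (j + 1))⁻¹ :=
        mul_le_mul_of_nonneg_right (mul_le_mul_of_nonneg_left hε (mul_nonneg hC₀ hQ₁)) h4

end Summit.HubbardSuperconductivity.HubbardSuperconductivity.Theorems.TwoVolumeSource

end
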